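import Summits.AtomisticToContinuum.FouriersLaw.Theorems.PhononMeanFreePathDefs
import Summits.AtomisticToContinuum.FouriersLaw.Theorems.OddSectorIrreversibilityWitnessGlueReflection

/-!
# Global flip `Π : (q, p) ↦ (−q, −p)` of the pinned chain (line `two-horizons-forecast-loss`, crux `IncoherentChannel`)

Helper file of line `two-horizons-forecast-loss` of crux `PhononMeanFreePath.IncoherentChannel`
(stmt-AtomisticToContinuum-11811), stub group "GlobalFlip": the registered stubs `transitionKernel_neg`,
`fcast_neg`, `integral_even_mul_fcast`.

Setting: `P = pinnedChain ω₂ lam β γ` (`ω₂ > 0`, `lam, β, γ ≥ 0`), Langevin baths at the two ends at ANY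
temperatures `T_L, T_R`, the constructed transition kernels `K_t = P.transitionKernel N T_L T_R t`
(`LangevinChainKernel`), the Gibbs law `μ₀ = P.gibbsMeasure (N+1) T` and the mean forecast of the far momentum
`v_t = fcast … N t = K_t p_N` (`Theorems/PhononMeanFreePathDefs`).

The GLOBAL FLIP `Π x = -x` commutes with the dynamics: the Hamiltonian is even (`hamiltonian_neg`: the pinning
`ω₂ q²/2 + lam q⁴/4` and the FPU interaction `r²/2 + β r⁴/4` are even, the kinetic energy is even), so the
Langevin drift is odd (`drift_neg`), the noise enters additively and the pair of Brownian paths is symmetric in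
law under path negation (`map_neg_pairPath_eq_map_pairPath`, Mathlib's `IsPreBrownianReal.neg` + uniqueness of
the law of a pre-Brownian motion on path space, `IsPreBrownianReal.map_path_eq`). Hence, mirroring the
site-reflection covariance of `OddSectorIrreversibilityWitnessGlueReflection`:

* `chainFlow_neg`, `solMap_neg` — the pathwise solution started at `-x` and driven by the negated noise is the
  negated solution (uniqueness of the integral equation, `pinnedChain_eqOn_chainFlow`);
* `transitionKernel_neg` (registered) — `K_t(-x, ·) = Π_* K_t(x, ·)` for all `T_L, T_R` (no bath swap needed);
* `fcast_neg` (registered) — `v_t(-z) = -v_t(z)`: the mean forecast lives in the `Π`-odd sector;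
* `measurePreserving_neg_gibbsMeasure` — `Π` preserves `μ₀` (`H ∘ Π = H`, Lebesgue measure is flip invariant);
* `integral_even_mul_fcast` (registered) — `∫ G · v_t dμ₀ = 0` for every `Π`-even `G` (no integrability
  needed: the Bochner junk value `0` is consistent).
-/

noncomputable section

namespace Summit.AtomisticToContinuum.FouriersLaw.Theorems.PhononMeanFreePath

open MeasureTheory Set Filter Topology ProbabilityTheory
open scoped NNReal ENNReal
open Literature.MathematicalPhysics.KineticTheory.HeatConduction
open Literature.Probability.Process

/-! ## Algebra of the global flip -/

section Algebra

variable {ω₂ lam β γ : ℝ}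

/-- **The Hamiltonian of the pinned chain is even under the global flip** `(q, p) ↦ (-q, -p)` (even pinning,
even interaction, even kinetic energy). [folklore] -/
theorem hamiltonian_neg (N : ℕ) (x : PhaseSpace N) :
    (pinnedChain ω₂ lam β γ).hamiltonian N (-x) = (pinnedChain ω₂ lam β γ).hamiltonian N x := by
  simp only [OscillatorChain.hamiltonian, pinnedChain, Prod.fst_neg, Prod.snd_neg, Pi.neg_apply]
  congr 1
  · refine Finset.sum_congr rfl fun i _ => ?_
    ring
  · refine Finset.sum_congr rfl fun i _ => Finset.sum_congr rfl fun j _ => ?_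
    split_ifs
    · ring
    · rfl

/-- **`∂_{q_i} H` is odd under the global flip** (chain rule along `t ↦ -t` in the `i`-th position
coordinate, `deriv_comp_neg`; no differentiability needed). [folklore] -/
theorem partialQ_hamiltonian_neg (N : ℕ) (i : Fin N) (x : PhaseSpace N) :
    partialQ i ((pinnedChain ω₂ lam β γ).hamiltonian N) (-x) =
      -partialQ i ((pinnedChain ω₂ lam β γ).hamiltonian N) x := by
  unfold partialQ
  set g : ℝ → ℝ := fun t => (pinnedChain ω₂ lam β γ).hamiltonian N (Function.update x.1 i t, x.2) with hg
  have h : (fun t => (pinnedChain ω₂ lam β γ).hamiltonian N (Function.update (-x).1 i t, (-x).2)) =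
      fun t => g (-t) := by
    funext t
    simp only [hg]
    rw [← hamiltonian_neg N (Function.update x.1 i (-t), x.2)]
    simp only [Prod.neg_mk, ← Function.update_neg, neg_neg, Prod.fst_neg, Prod.snd_neg]
  rw [h, deriv_comp_neg]
  simp only [Prod.fst_neg, Pi.neg_apply, neg_neg]

/-- **The Langevin drift is odd under the global flip**: `Y(-z) = -Y(z)` (`∇_q H` is odd, the friction is
linear). [folklore] -/
theorem drift_neg (N : ℕ) (z : PhaseSpace N) :
    (pinnedChain ω₂ lam β γ).drift N (-z) = -(pinnedChain ω₂ lam β γ).drift N z := by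
  unfold OscillatorChain.drift
  ext i
  · rfl
  · simp only [Prod.snd_neg, Pi.neg_apply, partialQ_hamiltonian_neg]
    ring

/-- **Negating a pair of continuous driving paths negates the noise.** [folklore] -/
theorem chainNoise_neg {N : ℕ} (c_L c_R : ℝ) {w : WienerPair} (h1 : Continuous w.1) (h2 : Continuous w.2) :
    chainNoise N c_L c_R (-w) = fun t => -chainNoise N c_L c_R w t := by
  have h1' : Continuous (-w).1 := h1.neg
  have h2' : Continuous (-w).2 := h2.neg
  funext t i
  rw [Pi.neg_apply, chainNoise_of_continuous c_L c_R h1' h2', chainNoise_of_continuous c_L c_R h1 h2]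
  simp only [Prod.fst_neg, Prod.snd_neg, Pi.neg_apply]
  ring

end Algebra

/-! ## Equivariance of the pathwise solution and of the transition kernels -/

section Flow

variable {ω₂ lam β γ : ℝ} (hω : 0 < ω₂) (hl : 0 ≤ lam) (hβ : 0 ≤ β) (hγ : 0 ≤ γ)
include hω hl hβ hγ

/-- **The pathwise solution is flip equivariant**: driving the flipped initial condition with the negated
noise path gives the flipped solution (uniqueness of the integral equation). [folklore] -/
theorem chainFlow_neg (N : ℕ) (x : PhaseSpace N) {η : ℝ → Fin N → ℝ} (hη : Continuous η) (t : ℝ) :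
    (pinnedChain ω₂ lam β γ).chainFlow N (-x) (fun s => -η s) t =
      -((pinnedChain ω₂ lam β γ).chainFlow N x η t) := by
  set P := pinnedChain ω₂ lam β γ
  have hη' : Continuous fun s => -η s := hη.neg
  rcases le_or_gt t 0 with ht | ht
  · rw [pinnedChain_chainFlow_of_nonpos ω₂ lam β γ N _ hη' ht, pinnedChain_chainFlow_of_nonpos ω₂ lam β γ N _ hη ht,
      neg_add]
    congr 1
    simp only [Prod.neg_mk, neg_zero]
  -- `t > 0`: the flipped solution solves the flipped integral equation
  have hyc : Continuous (P.chainFlow N x η) := pinnedChain_continuous_chainFlow hω hl hβ hγ N x hη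
  have hsol := pinnedChain_isIntegralSolutionOn_chainFlow hω hl hβ hγ N x hη t
  have hz : Literature.Analysis.ODE.IsIntegralSolutionOn (P.drift N) (OscillatorChain.forcing (-x) (fun s => -η s))
      (fun s => -(P.chainFlow N x η s)) t := by
    intro s hs
    have h := hsol s hs
    show -(P.chainFlow N x η s) = _
    rw [h, neg_add]
    have h2 : -(∫ r in (0 : ℝ)..s, P.drift N (P.chainFlow N x η r)) =
        ∫ r in (0 : ℝ)..s, P.drift N (-(P.chainFlow N x η r)) := by
      rw [← intervalIntegral.integral_neg]
      refine intervalIntegral.integral_congr fun r _ => ?_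
      exact (drift_neg N _).symm
    rw [h2]
    congr 1
    simp only [OscillatorChain.forcing, neg_add, Prod.neg_mk, neg_zero]
  have hzc : Continuous fun s => -(P.chainFlow N x η s) := hyc.neg
  have heq := pinnedChain_eqOn_chainFlow hω hl hβ hγ N (-x) hη' hz hzc (show t ∈ Icc 0 t from ⟨ht.le, le_rfl⟩)
  exact heq.symm

/-- **The solution map is flip equivariant under negation of the driving pair** (pairs of continuous paths;
any bath temperatures). [folklore] -/
theorem solMap_neg (N : ℕ) (T_L T_R t : ℝ) (x : PhaseSpace N) {w : WienerPair} (h1 : Continuous w.1)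
    (h2 : Continuous w.2) :
    (pinnedChain ω₂ lam β γ).solMap N T_L T_R t (-x) (-w) = -((pinnedChain ω₂ lam β γ).solMap N T_L T_R t x w) := by
  unfold OscillatorChain.solMap
  rw [chainNoise_neg _ _ h1 h2]
  exact chainFlow_neg hω hl hβ hγ N x (continuous_chainNoise _ _ w) t

/-- The solution map driven by the Brownian pair, at the flipped initial condition, is the flip of the solution
map driven by the negated Brownian pair. [folklore] -/
theorem solMap_neg_pairPath (N : ℕ) (T_L T_R t : ℝ) (x : PhaseSpace N) (ω : WienerPair) :
    (pinnedChain ω₂ lam β γ).solMap N T_L T_R t (-x) (pairPath ω) =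
      -((pinnedChain ω₂ lam β γ).solMap N T_L T_R t x (-pairPath ω)) := by
  have h1 : Continuous (-pairPath ω).1 := (continuous_pairPath_fst ω).neg
  have h2 : Continuous (-pairPath ω).2 := (continuous_pairPath_snd ω).neg
  have h := solMap_neg hω hl hβ hγ N T_L T_R t x h1 h2
  rw [neg_neg] at h
  exact h

omit hω hl hβ hγ in
/-- **The negated Brownian pair has the law of the Brownian pair** (each coordinate: `-B` is a pre-Brownian
motion, Mathlib `IsPreBrownianReal.neg`, and two pre-Brownian motions with measurable marginals have the same
law on path space, `IsPreBrownianReal.map_path_eq`; the two coordinates are independent). [folklore] -/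
theorem map_neg_pairPath_eq_map_pairPath :
    wienerPair.map (fun ω => -pairPath ω) = wienerPair.map pairPath := by
  haveI := Literature.Probability.RandomPlanarGeometry.isProbabilityMeasure_preWienerMeasure'
  have hneg : (fun ω : WienerPair => -pairPath ω) =
      Prod.map (fun (ω₁ : ℝ≥0 → ℝ) (u : ℝ≥0) => -brownian u ω₁) fun (ω₂ : ℝ≥0 → ℝ) (u : ℝ≥0) => -brownian u ω₂ :=
    rfl
  have hmeas : Measurable fun (ω₁ : ℝ≥0 → ℝ) (u : ℝ≥0) => -brownian u ω₁ :=
    measurable_pi_lambda _ fun u => (measurable_brownian u).neg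
  have hlaw : preWienerMeasure.map (fun (ω₁ : ℝ≥0 → ℝ) (u : ℝ≥0) => -brownian u ω₁) =
      preWienerMeasure.map fun (ω₁ : ℝ≥0 → ℝ) (u : ℝ≥0) => brownian u ω₁ :=
    IsPreBrownianReal.map_path_eq Literature.Probability.RandomPlanarGeometry.isPreBrownianReal_brownian.neg
      Literature.Probability.RandomPlanarGeometry.isPreBrownianReal_brownian
      (fun t => (measurable_brownian t).neg) measurable_brownian
  rw [hneg, pairPath_eq_prodMap, wienerPair, ← Measure.map_prod_map _ _ hmeas hmeas,
    ← Measure.map_prod_map _ _ measurable_path measurable_path, hlaw]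

omit hω hl hβ hγ in
/-- The negated pair map is measurable (coordinatewise; the product σ-algebra on `WienerPair`). [folklore] -/
theorem measurable_neg_pairPath : Measurable fun ω : WienerPair => -pairPath ω := by
  have hmeas : Measurable fun (ω₁ : ℝ≥0 → ℝ) (u : ℝ≥0) => -brownian u ω₁ :=
    measurable_pi_lambda _ fun u => (measurable_brownian u).neg
  exact hmeas.prodMap hmeas

end Flow

/-- **Flip covariance of the transition kernels (registered stub `transitionKernel_neg`).** For the pinned chain
(`ω₂ > 0`, `lam, β, γ ≥ 0`) with baths at ANY temperatures `T_L, T_R`, every `N`, `t ≥ 0` and `x`: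
`K_t(-x, ·) = Π_* K_t(x, ·)` with `Π y = -y`. Proof: `K_t(x, ·)` is the law of `Φ_t(x, B)` under the product
Wiener measure (`pinnedChain_transitionKernel_apply`); `Φ_t(-x, B) = -Φ_t(x, -B)` pathwise (`solMap_neg_pairPath`:
odd drift, additive noise, uniqueness of the integral equation) and `-B` has the law of `B`
(`map_neg_pairPath_eq_map_pairPath`). [folklore] -/
theorem transitionKernel_neg : ∀ ω₂ lam β γ : ℝ, 0 < ω₂ → 0 ≤ lam → 0 ≤ β → 0 ≤ γ → ∀ (N : ℕ) (T_L T_R : ℝ) (t : NNReal) (x : PhaseSpace N), (pinnedChain ω₂ lam β γ).transitionKernel N T_L T_R t (-x) = ((pinnedChain ω₂ lam β γ).transitionKernel N T_L T_R t x).map (fun y : PhaseSpace N => -y) := by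
  intro ω₂ lam β γ hω hl hβ hγ N T_L T_R t x
  rw [pinnedChain_transitionKernel_apply hω hl hβ hγ N T_L T_R t (-x),
    pinnedChain_transitionKernel_apply hω hl hβ hγ N T_L T_R t x]
  have hsol' := (pinnedChain_measurable_solMap hω hl hβ hγ N T_L T_R t).comp (measurable_prodMk_left (x := x))
  have hsol : Measurable fun w : WienerPair => (pinnedChain ω₂ lam β γ).solMap N T_L T_R t x w := hsol'
  have hnegsol : Measurable fun w : WienerPair => -((pinnedChain ω₂ lam β γ).solMap N T_L T_R t x w) := hsol.neg
  have hg := pinnedChain_measurable_solMap_pairPath_right hω hl hβ hγ N T_L T_R t x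
  have hflip : Measurable fun y : PhaseSpace N => -y := measurable_neg
  have h1 : (fun ω : WienerPair => (pinnedChain ω₂ lam β γ).solMap N T_L T_R t (-x) (pairPath ω)) =
      (fun w : WienerPair => -((pinnedChain ω₂ lam β γ).solMap N T_L T_R t x w)) ∘ fun ω => -pairPath ω := by
    funext ω
    exact solMap_neg_pairPath hω hl hβ hγ N T_L T_R t x ω
  rw [h1, ← Measure.map_map hnegsol measurable_neg_pairPath, map_neg_pairPath_eq_map_pairPath,
    Measure.map_map hnegsol measurable_pairPath, Measure.map_map hflip hg]
  rfl

/-- **The mean forecast is odd under the global flip (registered stub `fcast_neg`).** For the pinned chain with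
both baths at `T`, every `N`, real `t` and microstate `z`: `v_t(-z) = -v_t(z)` (`K_t(-z, ·) = Π_* K_t(z, ·)`,
`transitionKernel_neg`, and `p_N ∘ Π = -p_N`; change of variables against the continuous integrand `p_N`, no
integrability needed). [folklore] -/
theorem fcast_neg : ∀ ω₂ lam β γ : ℝ, 0 < ω₂ → 0 ≤ lam → 0 ≤ β → 0 ≤ γ → ∀ (T : ℝ) (N : ℕ) (t : ℝ) (z : PhaseSpace (N + 1)), fcast ω₂ lam β γ T N t (-z) = - fcast ω₂ lam β γ T N t z := by
  intro ω₂ lam β γ hω hl hβ hγ T N t z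
  unfold fcast
  rw [transitionKernel_neg ω₂ lam β γ hω hl hβ hγ (N + 1) T T t.toNNReal z]
  have hflip : Measurable fun y : PhaseSpace (N + 1) => -y := measurable_neg
  have hc : Continuous fun y : PhaseSpace (N + 1) => y.2 (Fin.last N) := (continuous_apply (Fin.last N)).comp continuous_snd
  rw [integral_map hflip.aemeasurable hc.aestronglyMeasurable, ← integral_neg]
  rfl

/-! ## The flip preserves the Gibbs law; orthogonality of the forecast to the even sector -/

section Gibbs

variable {ω₂ lam β γ : ℝ}

/-- The global flip preserves Lebesgue measure on phase space. [folklore] -/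
theorem measurePreserving_neg_volume (N : ℕ) :
    MeasurePreserving (fun z : PhaseSpace N => -z) (volume : Measure (PhaseSpace N)) volume :=
  (Measure.measurePreserving_neg (volume : Measure (Fin N → ℝ))).prod
    (Measure.measurePreserving_neg (volume : Measure (Fin N → ℝ)))

/-- **The global flip preserves the Gibbs law** `μ_T = volume.tilted (-H/T)` of the pinned chain (every `N`, every
`T`): it preserves Lebesgue measure and `H ∘ Π = H`. [folklore] -/
theorem measurePreserving_neg_gibbsMeasure (N : ℕ) (T : ℝ) :
    MeasurePreserving (fun z : PhaseSpace N => -z) ((pinnedChain ω₂ lam β γ).gibbsMeasure N T)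
      ((pinnedChain ω₂ lam β γ).gibbsMeasure N T) := by
  have hemb : MeasurableEmbedding fun z : PhaseSpace N => -z := (MeasurableEquiv.neg (PhaseSpace N)).measurableEmbedding
  refine ⟨hemb.measurable, Measure.ext fun s hs => ?_⟩
  rw [OscillatorChain.gibbsMeasure_eq, Measure.map_apply hemb.measurable hs, Measure.tilted,
    withDensity_apply _ (hemb.measurable hs), withDensity_apply _ hs]
  have key := (measurePreserving_neg_volume N).setLIntegral_comp_preimage_emb hemb
    (fun x => ENNReal.ofReal (Real.exp (-(pinnedChain ω₂ lam β γ).hamiltonian N x / T) /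
      ∫ x, Real.exp (-(pinnedChain ω₂ lam β γ).hamiltonian N x / T) ∂volume)) s
  simpa only [hamiltonian_neg] using key

end Gibbs

/-- **The mean forecast is `L²(μ₀)`-orthogonal to every flip-even observable (registered stub
`integral_even_mul_fcast`).** For the pinned chain with both baths at `T` (any `T`, `ω₂ > 0`, `lam, β, γ ≥ 0`),
every `N`, real `t` and every `G` with `G(-z) = G(z)`: `∫ G · v_t dμ₀ = 0`. Proof: `Π` preserves `μ₀`
(`measurePreserving_neg_gibbsMeasure`) and `(G · v_t) ∘ Π = -(G · v_t)` (`fcast_neg`), so the integral equals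
its own negative (change of variables along the measurable involution `Π`; Bochner junk values included, no
integrability needed). [folklore] -/
theorem integral_even_mul_fcast : ∀ ω₂ lam β γ : ℝ, 0 < ω₂ → 0 ≤ lam → 0 ≤ β → 0 ≤ γ → ∀ (T : ℝ) (N : ℕ) (t : ℝ) (G : PhaseSpace (N + 1) → ℝ), (∀ z, G (-z) = G z) → ∫ z, G z * fcast ω₂ lam β γ T N t z ∂((pinnedChain ω₂ lam β γ).gibbsMeasure (N + 1) T) = 0 := by
  intro ω₂ lam β γ hω hl hβ hγ T N t G hG
  have hmp := measurePreserving_neg_gibbsMeasure (ω₂ := ω₂) (lam := lam) (β := β) (γ := γ) (N + 1) T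
  have hemb : MeasurableEmbedding fun z : PhaseSpace (N + 1) => -z :=
    (MeasurableEquiv.neg (PhaseSpace (N + 1))).measurableEmbedding
  have h := hmp.integral_comp hemb fun z => G z * fcast ω₂ lam β γ T N t z
  simp only [hG, fcast_neg ω₂ lam β γ hω hl hβ hγ, mul_neg, integral_neg] at h
  linarith

end Summit.AtomisticToContinuum.FouriersLaw.Theorems.PhononMeanFreePath

end
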